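import Summits.CriticalPhenomena.CardyFormulaZ2.Theorems.CardySusyWardParafermionFamiliesToSLESixWiredTouch

/-!
# The corner (dart) form of the `q = 1` parafermionic observable at the boundary arcs, I:
# touches of free-arc faces and the evaluation of boundary darts

Helper file for the crux `CardySusyWard.ParafermionFamiliesToSLESix` (stmt-CriticalPhenomena-10814),
line `exact-potential-schwarz-christoffel`, stub `stub_cornerFormStructure` (clauses (b), (c), (d):
Duminil-Copin 2012, Prop. 5 for the tree's corner observable `cornerObs` of `CardyComplexConeDefs.lean`).
Admissible data `E` with hole-free inner faces, completed configurations `β = E.bcBondConfig ω`, cut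
orbits `orb` of the start corner `c₀`, exit times `T`.

* `dart_iff_visit` — the dart `cornerSource v f → cornerTarget v f` is traversed by
  `medialExploration E ω` iff the coded corner `r` of `(v, f)` is `orb n` for some `n < T`;
  `fst_eq_of_dart` — a traversed dart `(y, f)` (even a junk one) has `y` as the vertex of its orbit
  corner, so darts at `B`-sites are never traversed (`cornerObs_eq_zero_of_mem_zdArcB`, clause (b)) and
  darts of non-inner faces neither (`cornerObs_eq_zero_of_not_isInnerFace`).
* `touch_of_reachable` — GENERAL TouchModulus (the tree's `S5.touch_of_reachable` is the anchor-square
  instance): for an inner face `f` with a corner `y` on the arc `B`, every corner `x` of `f` joined to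
  the arc `A` by `β`-open edges has its dart `(x, f)` on the cut orbit.  Same winding-number proof, the
  tube lemma being applied around all four faces at `y`.
* `touch_mono`, `touch_chain`, `turnCount_touch` — the free TouchPhase in this generality (verbatim
  the tree's chain argument over `S5.turnCount_eq_of_agree_off`).
* `cornerObs_eq_of_dartW`, `cornerPhase_eq_dartW` — evaluation at an arbitrary reading mesh `δ ≠ 0`.
* `freeArc_touch_law` (clause (c)) and `wiredArc_law` (clause (d), over the tree's
  `WiredTouch.visit_anti` / `turnCount_visit_const`).
-/

noncomputable section

namespace Summit.CriticalPhenomena.CardyFormulaZ2.Theorems.ParafermionFamiliesToSLESix.StripAnchored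

open MeasureTheory Function
open Literature.Probability.Percolation (bondPercolation half BondConfig openGraph vcell fcell cornerDart
  lf_cornerDart rf_cornerDart orbitTrail isTrail_orbitTrail mem_cdarts_orbitTrail_iff wnd_vcell_sub_wnd_fcell
  orbitTrail_eq_cornerOrbit cornerOrbit_ne_of_lt_minimalPeriod)
open Literature.Probability.LatticeModels
open Literature.Probability.LatticeModels.DiscreteDobrushin (startCorner exitTime isStartCorner_startCorner
  isInnerFace_of_lt_exitTime not_isInnerFace_exitTime medialExploration_eq_explorationList)
open Literature.Probability.LatticeModels.MedialTrail (wnd cdarts)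
open Summit.CriticalPhenomena.CardyFormulaZ2.Cruxes.EdgePrecompact.QkzStripBoundaryArm (cornerObs)
open Summit.CriticalPhenomena.CardyFormulaZ2.Cruxes.CoherentMorera.FinitaryGreenPairing (cornerPhase)
open S2 (sixthPhase dartW dartW_eq_single dartW_eq_zero cornerIntegrand cornerIntegrand_explorationList
  cornerObs_eq_integral)

namespace CornerForm

variable {E : DiscreteDobrushin} {ω ω' : BondConfig (Site 2)}

/-! ## Darts of the exploration as visits of coded corners -/

/-- The source of the dart `(y, f)` is an edge at `y` (also for junk pairs). [folklore] -/
theorem exists_cornerSource_eq (y f : Site 2) : ∃ a, cornerSource y f = s(y, a) := by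
  unfold cornerSource cornerEdge
  split_ifs <;> exact ⟨_, rfl⟩

/-- The target of the dart `(y, f)` is an edge at `y` (also for junk pairs). [folklore] -/
theorem exists_cornerTarget_eq (y f : Site 2) : ∃ b, cornerTarget y f = s(y, b) := by
  unfold cornerTarget cornerEdge
  split_ifs <;> exact ⟨_, rfl⟩

/-- A coded corner whose source and target are the source and target of the dart `(y, f)` has vertex
`y`. [folklore] -/
theorem fst_eq_of_cSrc_eq_of_cTgt_eq {p : Site 2 × Fin 4} {y f : Site 2} (hs : cSrc p = cornerSource y f)
    (ht : cTgt p = cornerTarget y f) : p.1 = y := by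
  obtain ⟨a, ha⟩ := exists_cornerSource_eq y f
  obtain ⟨b, hb⟩ := exists_cornerTarget_eq y f
  rw [ha, cSrc] at hs
  rw [hb, cTgt] at ht
  by_contra hne
  rcases Sym2.eq_iff.1 hs with ⟨h1, -⟩ | ⟨-, h1⟩
  · exact hne h1
  rcases Sym2.eq_iff.1 ht with ⟨h2, -⟩ | ⟨-, h2⟩
  · exact hne h2
  have h3 : cornerUnit p.2 = cornerUnit (p.2 + 1) := add_left_cancel (h1.trans h2.symm)
  exact absurd (cornerUnit_injective h3) (by simp)

/-- Vertices of the cut orbit avoid the arc `B`. [cite: Smirnov2001, §2] -/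
theorem orbit_fst_not_mem_zdArcB (hE : E.IsZdAdmissible) (n : ℕ) :
    (cornerOrbit (E.bcBondConfig ω) (startCorner hE) n).1 ∉ E.zdArcB := by
  have := S5.notB_iterate (ω := ω) hE (c := startCorner hE)
    (fun h => Set.disjoint_left.1 hE.disjoint (isStartCorner_startCorner hE).mem_zdArcA h) n
  rwa [← cornerOrbit_eq_iterate] at this

/-- **A traversed dart is a dart of the cut orbit**: if the exploration passes `cornerSource y f` at
position `k` and `cornerTarget y f` at position `k + 1`, then `k < T` and the `k`-th orbit corner has
source/target those two edges, hence vertex `y`. [cite: Smirnov2001, §2] -/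
theorem fst_eq_of_dart (hE : E.IsZdAdmissible) {y f : Site 2} {k : ℕ}
    (hk : (medialExploration E ω)[k]? = some (cornerSource y f))
    (hk' : (medialExploration E ω)[k + 1]? = some (cornerTarget y f)) :
    k < exitTime hE ω ∧ cSrc (cornerOrbit (E.bcBondConfig ω) (startCorner hE) k) = cornerSource y f ∧
      cTgt (cornerOrbit (E.bcBondConfig ω) (startCorner hE) k) = cornerTarget y f ∧
      (cornerOrbit (E.bcBondConfig ω) (startCorner hE) k).1 = y := by
  rw [medialExploration_eq_explorationList hE ω] at hk hk'
  obtain ⟨h1, hk⟩ := List.getElem?_eq_some_iff.1 hk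
  obtain ⟨h2, hk'⟩ := List.getElem?_eq_some_iff.1 hk'
  rw [getElem_explorationList] at hk hk'
  rw [cSrc_cornerOrbit_succ] at hk'
  rw [length_explorationList] at h2
  exact ⟨by omega, hk, hk', fst_eq_of_cSrc_eq_of_cTgt_eq hk hk'⟩

/-- **Dart = visit.** For a coded corner `r` with vertex `v` and face `f`, the exploration traverses the
dart `(v, f)` iff `r = orb n` for some `n < T`. [cite: Smirnov2001, §2] -/
theorem dart_iff_visit (hE : E.IsZdAdmissible) {r : Site 2 × Fin 4} {v f : Site 2} (h1 : r.1 = v)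
    (h2 : cFace r = f) (ω : BondConfig (Site 2)) :
    (∃ k : ℕ, (medialExploration E ω)[k]? = some (cornerSource v f) ∧
        (medialExploration E ω)[k + 1]? = some (cornerTarget v f)) ↔
      ∃ n < exitTime hE ω, cornerOrbit (E.bcBondConfig ω) (startCorner hE) n = r := by
  have hs : cornerSource v f = cSrc r := S1.cornerSource_of_coded (c := (v, f)) h1 h2
  have ht : cornerTarget v f = cTgt r := S1.cornerTarget_of_coded (c := (v, f)) h1 h2
  constructor
  · rintro ⟨k, hk, hk'⟩
    obtain ⟨hkT, hks, hkt, -⟩ := fst_eq_of_dart hE hk hk'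
    rw [hs] at hks
    rw [ht] at hkt
    exact ⟨k, hkT, eq_of_cSrc_eq_of_cTgt_eq hks hkt⟩
  · rintro ⟨n, hn, hnr⟩
    refine ⟨n, ?_, ?_⟩
    · rw [medialExploration_eq_explorationList hE ω, List.getElem?_eq_some_iff]
      refine ⟨by rw [length_explorationList]; omega, ?_⟩
      rw [getElem_explorationList, hnr, hs]
    · rw [medialExploration_eq_explorationList hE ω, List.getElem?_eq_some_iff]
      refine ⟨by rw [length_explorationList]; omega, ?_⟩
      rw [getElem_explorationList, cSrc_cornerOrbit_succ, hnr, ht]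

/-- A corner observable vanishes as soon as its dart is never traversed. [folklore] -/
theorem cornerObs_eq_zero_of_forall (δ : ℝ) {v f : Site 2}
    (h : ∀ (ω : BondConfig (Site 2)) (k : ℕ), (medialExploration E ω)[k]? = some (cornerSource v f) →
      (medialExploration E ω)[k + 1]? ≠ some (cornerTarget v f)) :
    cornerObs E δ v f = 0 := by
  rw [cornerObs_eq_integral]
  have key : ∀ ω : BondConfig (Site 2), cornerIntegrand δ v f (medialExploration E ω) = 0 := fun ω => by
    unfold cornerIntegrand
    refine Finset.sum_eq_zero fun k hk => ?_
    rw [Finset.mem_filter] at hk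
    exact absurd hk.2.2 (h ω k hk.2.1)
  simp_rw [key]
  exact integral_zero _ _

/-- **Clause (b): darts at a site of the dual-wired arc are never traversed**, so their corner
observable vanishes (for every face index, corner or not, and every reading mesh).
[cite: DuminilCopin2012Parafermion, Proposition 5] -/
theorem cornerObs_eq_zero_of_mem_zdArcB (hE : E.IsZdAdmissible) (δ : ℝ) {y : Site 2} (hy : y ∈ E.zdArcB)
    (f : Site 2) : cornerObs E δ y f = 0 :=
  cornerObs_eq_zero_of_forall δ fun ω k hk hk' => by
    obtain ⟨-, -, -, h⟩ := fst_eq_of_dart (ω := ω) hE hk hk'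
    exact orbit_fst_not_mem_zdArcB hE k (h ▸ hy)

/-- **Corners of non-inner faces are never traversed** (the darts of the cut orbit have inner faces).
[cite: Smirnov2001, §2] -/
theorem cornerObs_eq_zero_of_not_isInnerFace (hE : E.IsZdAdmissible) (δ : ℝ) {v f : Site 2}
    (hvf : IsCorner v f) (hf : ¬ E.IsInnerFace f) : cornerObs E δ v f = 0 := by
  obtain ⟨j, hj⟩ := exists_faceAt_of_isCorner hvf
  refine cornerObs_eq_zero_of_forall δ fun ω k hk hk' => hf ?_
  obtain ⟨n, hn, hnr⟩ := (dart_iff_visit hE (r := (v, j)) rfl hj.symm ω).1 ⟨k, hk, hk'⟩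
  have := isInnerFace_of_lt_exitTime hE ω hn
  rwa [hnr, cFace, ← hj] at this

/-! ## TouchModulus for a general free-arc face -/

/-- `j` runs over the four faces at a site starting anywhere. [folklore] -/
private theorem fin4_cases_add (j j' : Fin 4) :
    j = j' ∨ j = j' + 1 ∨ j = j' + 1 + 1 ∨ j = j' + 1 + 1 + 1 := by
  revert j j'; decide

/-- **TouchModulus, general form.** For admissible data with hole-free inner faces, a coded corner `r`
whose face is inner and has a corner `y` on the arc `B`, and whose vertex is joined to a site of the
arc `A` by open edges of the completed configuration, is a dart of the cut orbit: `r = orb n`, `n < T`.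
(Otherwise the forward orbit of `r` is a cycle of inner corners; its winding number jumps by one from
the vertex cell of `r` — zero, by the open path to the boundary — to the face cell of `r` — zero, being
by the tube lemma around the `B`-site `y` the winding number of a non-inner face at `y`.)
[cite: DuminilCopin2012Parafermion, Proposition 5] -/
theorem touch_of_reachable (hE : E.IsZdAdmissible) (hH : HoleFree {f : Site 2 | E.IsInnerFace f})
    {r : Site 2 × Fin 4} {y a : Site 2} (hf : E.IsInnerFace (cFace r)) (hy : IsCorner y (cFace r))
    (hyB : y ∈ E.zdArcB) (ha : a ∈ E.zdArcA)
    (hreach : (SimpleGraph.fromEdgeSet (E.bcBondConfig ω)).Reachable r.1 a) :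
    ∃ n < exitTime hE ω, cornerOrbit (E.bcBondConfig ω) (startCorner hE) n = r := by
  -- adapted from `S5.touch_of_reachable` (`…AnchoredWallFluxTouch.lean`)
  set β := E.bcBondConfig ω
  by_contra hoff
  push Not at hoff
  have hnB : r.1 ∉ E.zdArcB := by
    obtain ⟨p⟩ := hreach
    cases p with
    | nil => exact fun hB => Set.disjoint_left.1 hE.disjoint ha hB
    | cons hadj _ =>
      rw [SimpleGraph.fromEdgeSet_adj] at hadj
      exact fun hB => DiscreteDobrushin.not_mem_bcBondConfig_of_mem_zdArcB hE (Sym2.mem_mk_left _ _) hB hadj.1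
  have hp := S5.mem_periodicPts_of_off hE hf hnB hoff
  have hLin := S5.isInnerFace_iterate hE hf hnB hoff
  have hT := isTrail_orbitTrail hp
  set l := orbitTrail β r
  -- jump across the dart of `r`
  have h1 : wnd l (vcell r.1) - wnd l (fcell (cFace r)) = 1 := by
    have := wnd_vcell_sub_wnd_fcell hp r
    rwa [if_pos ⟨0, rfl⟩] at this
  -- no corner of the cycle has the `B`-site `y` as its vertex
  have hnoty : ∀ k : Fin 4, cornerDart (y, k) ∉ cdarts l := by
    intro k hmem
    obtain ⟨m, hm⟩ := (mem_cdarts_orbitTrail_iff hp).1 hmem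
    have := S5.notB_iterate (ω := ω) hE hnB m
    rw [hm] at this
    exact this hyB
  -- tube around `y`: the four face cells at `y` carry one winding number
  have htube : ∀ k : Fin 4, wnd l (fcell (faceAt y (k + 1))) = wnd l (fcell (faceAt y k)) := by
    intro k
    obtain ⟨-, -, h3⟩ := S2.tube_cornerDart hT.2.2 (S2.cornerDart_snd_eq (y, k)) (hnoty k) (hnoty (k + 1))
    rw [rf_cornerDart, rf_cornerDart] at h3
    exact h3
  have hall : ∀ j j' : Fin 4, wnd l (fcell (faceAt y j)) = wnd l (fcell (faceAt y j')) := by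
    intro j j'
    rcases fin4_cases_add j j' with rfl | rfl | rfl | rfl
    · rfl
    · exact htube j'
    · exact (htube (j' + 1)).trans (htube j')
    · exact ((htube (j' + 1 + 1)).trans (htube (j' + 1))).trans (htube j')
  -- hence the face cell of `r` has the winding number of a non-inner face at `y`, zero
  have h2 : wnd l (fcell (cFace r)) = 0 := by
    obtain ⟨j, hj⟩ := exists_faceAt_of_isCorner hy
    obtain ⟨g, hyg, hg⟩ := S5.exists_not_isInnerFace_of_mem_zdBoundary (E.zdArcB_subset_zdBoundary hyB)
    obtain ⟨j', hj'⟩ := exists_faceAt_of_isCorner hyg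
    have hg0 : wnd l (fcell g) = 0 := by
      rw [show l = orbitTrail β r from rfl, orbitTrail_eq_cornerOrbit]
      exact S2.wnd_fcell_eq_zero_of_not_isInnerFace hH (minimalPeriod_pos_of_mem_periodicPts hp)
        (by rw [cornerOrbit_eq_iterate]; exact iterate_minimalPeriod) (cornerOrbit_ne_of_lt_minimalPeriod hp)
        (fun m => by rw [cornerOrbit_eq_iterate]; exact hLin m) hg
    rw [hj, hall j j', ← hj', hg0]
  -- along the open path to `a ∈ A ⊆ zdBoundary`, the vertex cells carry winding number zero
  obtain ⟨g, hag, hg⟩ := S5.exists_not_isInnerFace_of_mem_zdBoundary (E.zdArcA_subset_zdBoundary ha)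
  have hβ : β ⊆ (zdGraph 2).edgeSet := fun e he =>
    SimpleGraph.edgeSet_subset_edgeSet.2 (meshGraph_le_zdGraph _ _)
      (SimpleGraph.edgeSet_subset_edgeSet.2 (discreteDomainGraph_le_meshGraph _ _) (E.bcBondConfig_subset ω he))
  have h4 : wnd l (vcell r.1) = 0 := by
    rw [S5.wnd_vcell_eq_of_reachable hp hβ hreach]
    exact S5.wnd_vcell_eq_zero_of_isCorner hH hp hLin hag hg
  rw [h2, h4] at h1
  norm_num at h1

/-- **TouchModulus** (both directions): under the same hypotheses on `r` and `y`, the corner `r` is on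
the cut orbit iff its vertex is joined to the wired arc by open edges of the completed configuration.
[cite: DuminilCopin2012Parafermion, Proposition 5] -/
theorem visit_iff_reachable (hE : E.IsZdAdmissible) (hH : HoleFree {f : Site 2 | E.IsInnerFace f})
    {r : Site 2 × Fin 4} {y : Site 2} (hf : E.IsInnerFace (cFace r)) (hy : IsCorner y (cFace r))
    (hyB : y ∈ E.zdArcB) :
    (∃ n < exitTime hE ω, cornerOrbit (E.bcBondConfig ω) (startCorner hE) n = r) ↔
      ∃ a ∈ E.zdArcA, (SimpleGraph.fromEdgeSet (E.bcBondConfig ω)).Reachable r.1 a := by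
  constructor
  · rintro ⟨n, -, hn⟩
    refine ⟨(startCorner hE).1, (isStartCorner_startCorner hE).mem_zdArcA, ?_⟩
    have := S5.reachable_start_of_orbit (E := E) (ω := ω) (startCorner hE) n
    rwa [hn] at this
  · rintro ⟨a, ha, hreach⟩
    exact touch_of_reachable hE hH hf hy hyB ha hreach

/-! ## TouchPhase for a general free-arc face -/

section Phase

variable (hE : E.IsZdAdmissible)

/-- **A touch persists when edges are opened.** [cite: DuminilCopin2012Parafermion, Proposition 5] -/
theorem touch_mono (hH : HoleFree {f : Site 2 | E.IsInnerFace f}) {r : Site 2 × Fin 4} {y : Site 2}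
    (hf : E.IsInnerFace (cFace r)) (hy : IsCorner y (cFace r)) (hyB : y ∈ E.zdArcB) (hle : ω ⊆ ω') {n : ℕ}
    (hrn : cornerOrbit (E.bcBondConfig ω) (startCorner hE) n = r) :
    ∃ m < exitTime hE ω', cornerOrbit (E.bcBondConfig ω') (startCorner hE) m = r := by
  have hreach := S5.reachable_start_of_orbit (E := E) (ω := ω) (startCorner hE) n
  rw [hrn] at hreach
  exact touch_of_reachable hE hH hf hy hyB (isStartCorner_startCorner hE).mem_zdArcA
    (hreach.mono (SimpleGraph.fromEdgeSet_mono (E.bcBondConfig_mono hle)))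

/-- **Opening finitely many edges keeps the touch and its turn count.** [cite: Smirnov2010, proof of Lemma 4.5] -/
theorem touch_chain (hH : HoleFree {f : Site 2 | E.IsInnerFace f}) {r : Site 2 × Fin 4} {y : Site 2}
    (hf : E.IsInnerFace (cFace r)) (hy : IsCorner y (cFace r)) (hyB : y ∈ E.zdArcB)
    {n : ℕ} (hn : n < exitTime hE ω) (hrn : cornerOrbit (E.bcBondConfig ω) (startCorner hE) n = r)
    {s : Set (Sym2 (Site 2))} (hs : s.Finite) :
    ∃ m < exitTime hE (ω ∪ s), cornerOrbit (E.bcBondConfig (ω ∪ s)) (startCorner hE) m = r ∧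
      turnCount (E.bcBondConfig (ω ∪ s)) (startCorner hE) m = turnCount (E.bcBondConfig ω) (startCorner hE) n := by
  -- adapted from `S5.touch_chain` (`…AnchoredWallFluxPhase.lean`)
  induction s, hs using Set.Finite.induction_on with
  | empty => rw [Set.union_empty]; exact ⟨n, hn, hrn, rfl⟩
  | @insert a s _ _ ih =>
    obtain ⟨m, hm, hrm, htc⟩ := ih
    rw [Set.union_insert]
    obtain ⟨m', hm', hrm'⟩ := touch_mono hE hH hf hy hyB (Set.subset_insert a (ω ∪ s)) hrm
    refine ⟨m', hm', hrm', ?_⟩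
    rw [← htc]
    refine (S5.turnCount_eq_of_agree_off hE hH (e := a) (fun e' he' => ?_) hm hm' hrm hrm').symm
    rw [DiscreteDobrushin.mem_bcBondConfig_iff, DiscreteDobrushin.mem_bcBondConfig_iff, Set.mem_insert_iff,
      or_iff_right he']

/-- **TouchPhase, general form**: two configurations visiting `r` (inner face with a `B`-corner) at
`orb n = r = orb' n'` have the same turn count there. [cite: Smirnov2010, proof of Lemma 4.5] -/
theorem turnCount_touch (hH : HoleFree {f : Site 2 | E.IsInnerFace f}) {r : Site 2 × Fin 4} {y : Site 2}
    (hf : E.IsInnerFace (cFace r)) (hy : IsCorner y (cFace r)) (hyB : y ∈ E.zdArcB)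
    {n n' : ℕ} (hn : n < exitTime hE ω) (hn' : n' < exitTime hE ω')
    (hrn : cornerOrbit (E.bcBondConfig ω) (startCorner hE) n = r)
    (hrn' : cornerOrbit (E.bcBondConfig ω') (startCorner hE) n' = r) :
    turnCount (E.bcBondConfig ω) (startCorner hE) n = turnCount (E.bcBondConfig ω') (startCorner hE) n' := by
  -- adapted from `S5.turnCount_touch` (`…AnchoredWallFluxPhase.lean`)
  have hfin : (discreteDomainGraph E.Ω E.δ).edgeSet.Finite := by
    have hV : (meshDomain E.Ω E.δ).Finite := meshDomain_finite hE.isBounded hE.delta_pos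
    refine ((hV.prod hV).image (fun q : Site 2 × Site 2 => s(q.1, q.2))).subset fun e he => ?_
    induction e using Sym2.ind with
    | _ a b =>
      have hab := discreteDomainGraph_adj_iff.1 ((SimpleGraph.mem_edgeSet _).1 he)
      exact ⟨(a, b), ⟨hab.2.1, hab.2.2⟩, rfl⟩
  obtain ⟨m, hm, hrm, htc⟩ := touch_chain hE hH hf hy hyB hn hrn (hfin.inter_of_right ω')
  obtain ⟨m', hm', hrm', htc'⟩ := touch_chain hE hH hf hy hyB hn' hrn' (hfin.inter_of_right ω)
  rw [← htc, ← htc']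
  refine S5.turnCount_eq_of_agree_off hE hH (e := cTgt r) (fun e' _ => ?_) hm hm' hrm hrm'
  simp only [DiscreteDobrushin.mem_bcBondConfig_iff, Set.mem_union, Set.mem_inter_iff]
  tauto

end Phase

end CornerForm

/-- **Registered one-line form `stub_cornerForm_touch`** of `CornerForm.touch_of_reachable` (general
TouchModulus; helper of stub `stub_cornerFormStructure` of line `exact-potential-schwarz-christoffel`): a
corner of an inner face with a `B`-corner, whose vertex is joined to the wired arc, is a dart of the cut
orbit. [cite: DuminilCopin2012Parafermion, Proposition 5] -/
theorem stub_cornerForm_touch : ∀ (E : DiscreteDobrushin) (hE : E.IsZdAdmissible) (ω : BondConfig (Site 2)) (r : Site 2 × Fin 4) (y a : Site 2), HoleFree {f : Site 2 | E.IsInnerFace f} → E.IsInnerFace (cFace r) → IsCorner y (cFace r) → y ∈ E.zdArcB → a ∈ E.zdArcA → (SimpleGraph.fromEdgeSet (E.bcBondConfig ω)).Reachable r.1 a → ∃ n < exitTime hE ω, cornerOrbit (E.bcBondConfig ω) (startCorner hE) n = r :=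
  fun _ hE _ _ _ _ hH hf hy hyB ha hreach => CornerForm.touch_of_reachable hE hH hf hy hyB ha hreach

end Summit.CriticalPhenomena.CardyFormulaZ2.Theorems.ParafermionFamiliesToSLESix.StripAnchored

end
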